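import Mathlib
import Literature.Analysis.FluidPDE.Tao2016AveragedNS.RenormalisedCascadeWaves
import Summits.NavierStokesRegularity.NavierStokesRegularity.Theorems.WakeRatchetAdmissibleEternalBoundCritical
import HarnessLib

/-!
# Scaling a table by a constant ↔ scaling the DSS profile: `IsDSSWave ε₀ α π T Φ → IsDSSWave ε₀ (c • α) π T (c⁻¹ • Φ)`
# (cell harvest/h2-tao-ladder, seat p2; support for K1(1) = `NoSurvivingDSSOne`, stmt-NavierStokesRegularity-20205)

MODEL lattice tables only; nothing about the Navier–Stokes equations; no item closed.

`NoSurvivingDSSOne` quantifies over NORMALISED tables (`InTableClass R`: every entry of modulus `≤ 1`), while a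
certificate may be produced for a table in another normalisation — e.g. the cell's `circuitTable q e E Λ (Λ₀K)`
has hand-off entry `Λ₀K`, which exceeds `1` for LS/A025-type constants (`K_cell = 1`) at every `ε₀ > 0`.
Because the profile system is homogeneous of degree two in `Φ` and linear in `α`, the pair `(α, Φ)` may be
traded for `(c • α, c⁻¹ • Φ)` for any `c ≠ 0` without changing `ε₀`, `π` or the delay `T` (hence without
changing `dssMu`/`Surviving`): `isDSSWave_smul_table`. With `tableQ_smul_table` / `tableA_smul_table` /
`tableB_smul_table` (linearity of the structure maps in the table). So «surviving DSS wave of SOME rescaling of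
α» and «… of α» are the same statement, and a table can always be normalised into the comparable class of the
appropriate spread before invoking the items.
-/

noncomputable section

-- `Summit.NavierStokesRegularity.NavierStokesRegularity.…` is the tree's (summit = problem) namespace; the
-- duplicated component is intended, so the dupNamespace linter is silenced for this file.
set_option linter.dupNamespace false

namespace Summit.NavierStokesRegularity.NavierStokesRegularity.Theorems

namespace DSSOneShift

open MeasureTheory
open Literature.Analysis.FluidPDE Literature.Analysis.FluidPDE.TaoCascade
open WakeRatchetCritical

variable {m : ℕ}

/-- The coordinate forms are linear in the table. [cite: Tao2016AveragedNS, §4 (4.1)] -/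
theorem qform_smul_table (c : ℝ) (α : Fin m → Fin m → Fin m → ℤ × ℤ × ℤ → ℝ) (μ : ℤ × ℤ × ℤ)
    (y x : Em m) (i : Fin m) : qform (c • α) μ y x i = c * qform α μ y x i := by
  unfold qform
  simp only [Pi.smul_apply, smul_eq_mul, Finset.mul_sum]
  exact Finset.sum_congr rfl fun i₁ _ => Finset.sum_congr rfl fun i₂ _ => by ring

/-- `Q_{c•α} = c • Q_α`. [cite: Tao2016AveragedNS, §4 (4.1), Lemma 4.1 (4.8)] -/
theorem tableQ_smul_table (c : ℝ) (α : Fin m → Fin m → Fin m → ℤ × ℤ × ℤ → ℝ) (x : Em m) :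
    tableQ (c • α) x = c • tableQ α x := by
  unfold tableQ
  rw [Finset.smul_sum]
  exact Finset.sum_congr rfl fun i _ => by rw [qform_smul_table, smul_smul]

/-- `A_{c•α} = c • A_α`. [cite: Tao2016AveragedNS, §4 (4.1), Lemma 4.1 (4.8)] -/
theorem tableA_smul_table (c : ℝ) (α : Fin m → Fin m → Fin m → ℤ × ℤ × ℤ → ℝ) (x : Em m) :
    tableA (c • α) x = c • tableA α x := by
  unfold tableA
  rw [Finset.smul_sum]
  exact Finset.sum_congr rfl fun i _ => by rw [qform_smul_table, smul_smul]

/-- `B_{c•α} = c • B_α`. [cite: Tao2016AveragedNS, §4 (4.1), Lemma 4.1 (4.8)] -/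
theorem tableB_smul_table (c : ℝ) (α : Fin m → Fin m → Fin m → ℤ × ℤ × ℤ → ℝ) (y x : Em m) :
    tableB (c • α) y x = c • tableB α y x := by
  unfold tableB
  rw [Finset.smul_sum]
  exact Finset.sum_congr rfl fun i _ => by rw [qform_smul_table, qform_smul_table, ← mul_add, smul_smul]

/-- **Table scaling ↔ profile scaling.**  If `Φ` is an admissible DSS wave of the table `α` at scale ratio
`1+ε₀` with shape `π` and delay `T`, then `c⁻¹ • Φ` is one of the table `c • α`, for every `c ≠ 0` (same `ε₀`,
`π`, `T` — so the energy ratio `dssMu ε₀ T` and `Surviving a ε₀ T` are untouched).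
[cite: Tao2016AveragedNS, §4 (4.1), Lemma 4.1 (4.8) (homogeneity of the cascade nonlinearity); cell vocabulary (`IsDSSWave`)] -/
theorem isDSSWave_smul_table {ρ : Type*} [Fintype ρ] {ε₀ : ℝ}
    {α : Fin m → Fin m → Fin m → ℤ × ℤ × ℤ → ℝ} {π : Equiv.Perm ρ} {T : ℝ} {Φ : ρ → ℝ → Em m}
    (h : IsDSSWave ε₀ α π T Φ) {c : ℝ} (hc : c ≠ 0) :
    IsDSSWave ε₀ (c • α) π T (fun r x => c⁻¹ • Φ r x) := by
  refine ⟨h.delay_pos, ?_, ?_, ?_⟩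
  · -- the profile system: scale `h.wave` by `c⁻¹` and use degree-two homogeneity / linearity in the table
    intro r x
    have hw := (h.wave r x).const_smul c⁻¹
    refine hw.congr_deriv ?_
    rw [tableQ_smul_table, tableA_smul_table, tableB_smul_table, tableQ_smul, tableA_smul,
      tableB_smul_smul]
    simp only [smul_add, smul_neg, smul_smul, one_smul]
    match_scalars <;> field_simp
  · -- integrable summed mass: `sMass (c⁻¹ • Φ) = |c⁻¹| · sMass Φ`
    have hm : (sMass fun r x => c⁻¹ • Φ r x) = fun x => |c⁻¹| * sMass Φ x := by
      funext x
      simp only [sMass, norm_smul, Real.norm_eq_abs, Finset.mul_sum]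
    rw [hm]
    exact h.mass.const_mul _
  · -- bounded renormalised energy: `wEnergy 1 (c⁻¹ • Φ) = c⁻² · wEnergy 1 Φ`
    obtain ⟨x₀, P, hP⟩ := h.bdd
    refine ⟨x₀, c⁻¹ ^ 2 * P, fun x hx => ?_⟩
    have hw : wEnergy 1 (fun r x => c⁻¹ • Φ r x) x = c⁻¹ ^ 2 * wEnergy 1 Φ x := by
      simp only [wEnergy, sEnergy, norm_smul, Real.norm_eq_abs, mul_pow, sq_abs, Finset.mul_sum]
      exact Finset.sum_congr rfl fun r _ => by ring
    rw [hw]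
    exact mul_le_mul_of_nonneg_left (hP x hx) (sq_nonneg _)

end DSSOneShift

end Summit.NavierStokesRegularity.NavierStokesRegularity.Theorems
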